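import Literature.AnabelianGeometry.SemiGraphs.BTempQDPairCoversDirectedCover
import Literature.AnabelianGeometry.SemiGraphs.BTempQDPairZeroProper
import HarnessLib

/-!
# Semi-graphs of anabelioids, Appendix, proof of Theorem A.4: the 1-proper covers of a QD-pair of
# `B^temp(Π)` by strongly connected QD-pairs form a DIRECTED system (part 2 of 2)

Mochizuki, *Semi-graphs of anabelioids*, Publ. RIMS **42** (2006) 221–322, Appendix, proof of
Theorem A.4, manuscript p. 84 (PRIMS p. 314 ll. 1–8) [cite: MochizukiSemiAnbd2006, Thm A.4 proof p.84]:
"Now one verifies easily that any two 1-proper morphisms of strongly connected QD-pairs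
`(B″, Γ_B″) → (B, Γ_B)`, `(B‴, Γ_B‴) → (B, Γ_B)` fit into a commutative diagram of 1-proper
morphisms of strongly connected QD-pairs of `D_i`
  `(B⁗, Γ_B⁗) → (B″, Γ_B″)`, `(B⁗, Γ_B⁗) → (B‴, Γ_B‴)` [over `(B, Γ_B)`].
Thus … `Hom^((B, Γ_B), (C, Γ_C)) := lim_→ Hom̄((B′, Γ_B′), (C, Γ_C))` [is a] filtered inductive limit".

Row **A4-S-dir** of the abc-iut cell's `plan/L3/SUBDAG-SemiAnbd-Cor311.md` (holder abc-iut-w5-d129;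
this file by wave-4 seat abc-iut-w4-d081), PART 2, over the construction of part 1
(`BTempQDPairCoversDirectedCover.lean`: `B⁗ :=` the `Π`-orbit of `(b″, b‴)` in `B″ ×_{B/Γ_B} B‴`,
`Γ_B⁗ :=` the pairs `(γ″, γ‴) ∈ Γ_B″ × Γ_B‴` stabilising it, the projections `t`, `t′` and their lifting
clauses):

* the QUOTIENT clauses of `t`, `t′` and of the composite `(B⁗, Γ_B⁗) → (B, Γ_B)` (the fibre of `t`
  through `a · (b″, b‴)` is `{a · (b″, h · b‴) | h ∈ Stab(b″)}`, swept out by the pairs `(1, k‴)`,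
  `k‴ ∈ Ker(Γ_B‴ → Γ_B)`; symmetrically for `t′`; pairs `(k″, k‴)` for the composite) —
  `QDPair.isQuotient_iff_surjective` (`BTempQDPairQuotients.lean`, abc-iut-w5-d129);
* the 0-PROPERNESS clauses, consumed BY NAME from the shared helper of seat abc-iut-w5-d220
  (`QDPair.isZeroProper_of_surjective`, `BTempQDPairZeroProper.lean`: surjective on points ⟹ 0-proper);
* hence `t`, `t′`, `t ≫ (B″ → B)` are 1-PROPER, and **`QDPair.oneProperCoversDirected P :
  OneProperCoversDirected P`** for EVERY QD-pair `P` of `B^temp(Π)`, `Π` any topological group (no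
  hypothesis: a 1-proper cover forces `B` connected, and with none the statement is vacuous);
* consequences for row A4-lim: `Hom^((B, Γ_B), (C, Γ_C)) → Hom_T(B/Γ_B, C/Γ_C)` is INJECTIVE for every
  pair (`QDPair.homHatToHom_injective`, via abc-iut-w5-d129's `homHatToHom_injective_of_directed` and
  abc-iut-w4-d081's `homBarToHom_injective`), and the reconstruction `HomHatReconstructs P C` now
  follows from the realisation clause `HomHatRealised P C` alone (`homHatReconstructs_of_realised`;
  that clause is row A4-S-real, seat abc-iut-w5-d220).

Pure proofs; elementary `Π`-set theory; nothing refers to the IUT corpus and no side is taken on any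
disputed claim.
-/

open CategoryTheory

namespace Literature.AnabelianGeometry.SemiGraphs

open Literature.AlgebraicGeometry.Frobenioids (IsConnectedObj)
open Literature.AlgebraicGeometry.Frobenioids.QuasiTemperoid.BTempConnected (hom_ρ hom_ext_apply
  ρ_mul_apply ρ_inv_apply exists_ρ_eq_of_isConnectedObj)

universe u

namespace QDPair

namespace OneProperCover

variable {G : Type u} [Group G] [TopologicalSpace G] [IsTopologicalGroup G]
variable {P : QDPair (BTemp G)} (c c' : OneProperCover P)

/-! ### Quotient clauses -/

/-- A pair `(k″, k‴) ∈ Ker(Γ_B″ → Γ_B) × Ker(Γ_B‴ → Γ_B)` realising `h ∈ Stab(b)` on `(b″, b‴)`: for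
`h · b = b` there are `k″`, `k‴` in the kernels with `(k″ b″, k‴ b‴) = h · (b″, b‴)`.
[cite: MochizukiSemiAnbd2006, Thm A.4 proof p.84] -/
theorem exists_kernel_pair {h : G}
    (hh : P.A.obj.ρ h (c.hom.hom.hom.hom (pt₁ c)) = c.hom.hom.hom.hom (pt₁ c)) :
    ∃ (k : Aut c.src.A) (hk : k ∈ Hom.stabilizer c.hom) (k' : Aut c'.src.A)
      (hk' : k' ∈ Hom.stabilizer c'.hom),
      pairAut c c' (⟨k, hk.1⟩, ⟨k', hk'.1⟩) ∈ BTemp.stabOrbit (amb c c') (basePt c c') ∧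
      ((pairAut c c' (⟨k, hk.1⟩, ⟨k', hk'.1⟩)).hom.hom.hom (basePt c c') : (amb c c').obj.V) =
        (amb c c').obj.ρ h (basePt c c') := by
  have h₁ : (c.hom.hom.hom.hom (pt₁ c) : P.A.obj.V) = c.hom.hom.hom.hom (c.src.A.obj.ρ h (pt₁ c)) := by
    rw [hom_ρ, hh]
  have h₂ : (c'.hom.hom.hom.hom (pt₂ c c') : P.A.obj.V) =
      c'.hom.hom.hom.hom (c'.src.A.obj.ρ h (pt₂ c c')) := by
    rw [hom_ρ, pt₂_spec, hh]
  obtain ⟨k, hk, hkpt⟩ := c.exists_stabilizer_apply_eq h₁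
  obtain ⟨k', hk', hk'pt⟩ := c'.exists_stabilizer_apply_eq h₂
  have hpt : ((pairAut c c' (⟨k, hk.1⟩, ⟨k', hk'.1⟩)).hom.hom.hom (basePt c c') : (amb c c').obj.V) =
      (amb c c').obj.ρ h (basePt c c') :=
    BTemp.pullbackObj_ext _ _ hkpt hk'pt
  exact ⟨k, hk, k', hk', ⟨h, hpt.symm⟩, hpt⟩

/-- For `h ∈ Stab(b″)`: a pair `(1, k‴)`, `k‴ ∈ Ker(Γ_B‴ → Γ_B)`, realising `h` on `(b″, b‴)` (the
fibre of `t` through `(b″, b‴)` is `{(b″, h · b‴) | h ∈ Stab(b″)}`).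
[cite: MochizukiSemiAnbd2006, Thm A.4 proof p.84] -/
theorem exists_kernel_pair_fst {h : G} (hh : c.src.A.obj.ρ h (pt₁ c) = pt₁ c) :
    ∃ (k' : Aut c'.src.A) (hk' : k' ∈ Hom.stabilizer c'.hom),
      pairAut c c' (⟨1, c.src.Γ.one_mem⟩, ⟨k', hk'.1⟩) ∈ BTemp.stabOrbit (amb c c') (basePt c c') ∧
      ((pairAut c c' (⟨1, c.src.Γ.one_mem⟩, ⟨k', hk'.1⟩)).hom.hom.hom (basePt c c') :
          (amb c c').obj.V) = (amb c c').obj.ρ h (basePt c c') := by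
  have h₂ : (c'.hom.hom.hom.hom (pt₂ c c') : P.A.obj.V) =
      c'.hom.hom.hom.hom (c'.src.A.obj.ρ h (pt₂ c c')) := by
    rw [hom_ρ_pt₂, hh, pt₂_spec]
  obtain ⟨k', hk', hk'pt⟩ := c'.exists_stabilizer_apply_eq h₂
  have hpt : ((pairAut c c' (⟨1, c.src.Γ.one_mem⟩, ⟨k', hk'.1⟩)).hom.hom.hom (basePt c c') :
      (amb c c').obj.V) = (amb c c').obj.ρ h (basePt c c') :=
    BTemp.pullbackObj_ext _ _ hh.symm hk'pt
  exact ⟨k', hk', ⟨h, hpt.symm⟩, hpt⟩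

/-- For `h ∈ Stab(b‴)`: a pair `(k″, 1)`, `k″ ∈ Ker(Γ_B″ → Γ_B)`, realising `h` on `(b″, b‴)`.
[cite: MochizukiSemiAnbd2006, Thm A.4 proof p.84] -/
theorem exists_kernel_pair_snd {h : G} (hh : c'.src.A.obj.ρ h (pt₂ c c') = pt₂ c c') :
    ∃ (k : Aut c.src.A) (hk : k ∈ Hom.stabilizer c.hom),
      pairAut c c' (⟨k, hk.1⟩, ⟨1, c'.src.Γ.one_mem⟩) ∈ BTemp.stabOrbit (amb c c') (basePt c c') ∧
      ((pairAut c c' (⟨k, hk.1⟩, ⟨1, c'.src.Γ.one_mem⟩)).hom.hom.hom (basePt c c') :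
          (amb c c').obj.V) = (amb c c').obj.ρ h (basePt c c') := by
  have h₁ : (c.hom.hom.hom.hom (pt₁ c) : P.A.obj.V) = c.hom.hom.hom.hom (c.src.A.obj.ρ h (pt₁ c)) := by
    rw [← hom_ρ_pt₂, hh, pt₂_spec]
  obtain ⟨k, hk, hkpt⟩ := c.exists_stabilizer_apply_eq h₁
  have hpt : ((pairAut c c' (⟨k, hk.1⟩, ⟨1, c'.src.Γ.one_mem⟩)).hom.hom.hom (basePt c c') :
      (amb c c').obj.V) = (amb c c').obj.ρ h (basePt c c') :=
    BTemp.pullbackObj_ext _ _ hkpt hh.symm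
  exact ⟨k, hk, ⟨h, hpt.symm⟩, hpt⟩

/-- Reduction of a fibre statement to the base point: if `g ∈ Aut(B⁗)` moves `(b″, b‴)` to
`h · (b″, b‴)`, then it moves `a · (b″, b‴)` to `(a h) · (b″, b‴)`.
[cite: MochizukiSemiAnbd2006, Thm A.4 proof p.84] -/
theorem aut_apply_ρ_orbitPt (g : Aut (coverObj c c')) (a h : G)
    (hg : (g.hom.hom.hom (BTemp.orbitPt _ _) : (coverObj c c').obj.V) =
      (coverObj c c').obj.ρ h (BTemp.orbitPt _ _)) :
    (g.hom.hom.hom ((coverObj c c').obj.ρ a (BTemp.orbitPt _ _)) : (coverObj c c').obj.V) =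
      (coverObj c c').obj.ρ (a * h) (BTemp.orbitPt _ _) := by
  rw [hom_ρ, hg, ρ_mul_apply]

/-- **Quotient clause for `t`**: `B⁗ → B″` forms a quotient of `(B⁗, Ker(Γ_B⁗ → Γ_B″))` — the
fibre of `t` through `a · (b″, b‴)` is swept out by the pairs `(1, k‴)`, `k‴ ∈ Ker(Γ_B‴ → Γ_B)`.
[cite: MochizukiSemiAnbd2006, Thm A.4 proof p.84] -/
theorem fst_isQuotient :
    (⟨(coverPair c c').A, Hom.stabilizer (fst c c')⟩ : QDPair (BTemp G)).IsQuotient (fst c c').hom := by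
  refine (isQuotient_iff_surjective _).mpr ⟨fun g hg => hg.2, ?_, ?_⟩
  · intro y
    obtain ⟨a, rfl⟩ := exists_ρ_eq_of_isConnectedObj c.src.A c.isStronglyConnected (pt₁ c) y
    exact ⟨(coverObj c c').obj.ρ a (BTemp.orbitPt _ _), rfl⟩
  · intro z₁ z₂ hz
    obtain ⟨a₁, rfl⟩ := exists_ρ_orbitPt c c' z₁
    obtain ⟨a₂, rfl⟩ := exists_ρ_orbitPt c c' z₂
    -- `h := a₁⁻¹ a₂` fixes `b″`
    change c.src.A.obj.ρ a₁ (pt₁ c) = c.src.A.obj.ρ a₂ (pt₁ c) at hz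
    have hh1 : c.src.A.obj.ρ (a₁⁻¹ * a₂) (pt₁ c) = pt₁ c := by
      rw [ρ_mul_apply, ← hz, ρ_inv_apply]
    obtain ⟨k', hk', hst, hpt⟩ := exists_kernel_pair_fst c c' hh1
    let g := BTemp.restrictOrbit _ _ ⟨_, hst⟩
    have hgpt : (g.hom.hom.hom (BTemp.orbitPt _ _) : (coverObj c c').obj.V) =
        (coverObj c c').obj.ρ (a₁⁻¹ * a₂) (BTemp.orbitPt _ _) := Subtype.ext hpt
    refine ⟨g, ⟨restrictOrbit_mem_coverGroup c c' _ hst, hom_ext_apply fun _ => rfl⟩, ?_⟩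
    have key := aut_apply_ρ_orbitPt c c' g a₁ (a₁⁻¹ * a₂) hgpt
    rw [mul_inv_cancel_left] at key
    exact key

/-- **Quotient clause for `t′`** (symmetric). [cite: MochizukiSemiAnbd2006, Thm A.4 proof p.84] -/
theorem snd_isQuotient :
    (⟨(coverPair c c').A, Hom.stabilizer (snd c c')⟩ : QDPair (BTemp G)).IsQuotient (snd c c').hom := by
  refine (isQuotient_iff_surjective _).mpr ⟨fun g hg => hg.2, ?_, ?_⟩
  · intro y
    obtain ⟨a, rfl⟩ := exists_ρ_eq_of_isConnectedObj c'.src.A c'.isStronglyConnected (pt₂ c c') y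
    exact ⟨(coverObj c c').obj.ρ a (BTemp.orbitPt _ _), rfl⟩
  · intro z₁ z₂ hz
    obtain ⟨a₁, rfl⟩ := exists_ρ_orbitPt c c' z₁
    obtain ⟨a₂, rfl⟩ := exists_ρ_orbitPt c c' z₂
    change c'.src.A.obj.ρ a₁ (pt₂ c c') = c'.src.A.obj.ρ a₂ (pt₂ c c') at hz
    have hh2 : c'.src.A.obj.ρ (a₁⁻¹ * a₂) (pt₂ c c') = pt₂ c c' := by
      rw [ρ_mul_apply, ← hz, ρ_inv_apply]
    obtain ⟨k, hk, hst, hpt⟩ := exists_kernel_pair_snd c c' hh2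
    let g := BTemp.restrictOrbit _ _ ⟨_, hst⟩
    have hgpt : (g.hom.hom.hom (BTemp.orbitPt _ _) : (coverObj c c').obj.V) =
        (coverObj c c').obj.ρ (a₁⁻¹ * a₂) (BTemp.orbitPt _ _) := Subtype.ext hpt
    refine ⟨g, ⟨restrictOrbit_mem_coverGroup c c' _ hst, hom_ext_apply fun _ => rfl⟩, ?_⟩
    have key := aut_apply_ρ_orbitPt c c' g a₁ (a₁⁻¹ * a₂) hgpt
    rw [mul_inv_cancel_left] at key
    exact key

/-- **Quotient clause for the composite `(B⁗, Γ_B⁗) → (B, Γ_B)`**: the fibre through `a · (b″, b‴)`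
over `b` is swept out by the pairs `(k″, k‴)` of kernel elements.
[cite: MochizukiSemiAnbd2006, Thm A.4 proof p.84] -/
theorem comp_isQuotient :
    (⟨(coverPair c c').A, Hom.stabilizer (fst c c' ≫ c.hom)⟩ : QDPair (BTemp G)).IsQuotient
      (fst c c' ≫ c.hom).hom := by
  refine (isQuotient_iff_surjective _).mpr ⟨fun g hg => hg.2, ?_, ?_⟩
  · intro y
    obtain ⟨x, rfl⟩ := c.hom_surjective y
    obtain ⟨a, rfl⟩ := exists_ρ_eq_of_isConnectedObj c.src.A c.isStronglyConnected (pt₁ c) x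
    exact ⟨(coverObj c c').obj.ρ a (BTemp.orbitPt _ _), rfl⟩
  · intro z₁ z₂ hz
    obtain ⟨a₁, rfl⟩ := exists_ρ_orbitPt c c' z₁
    obtain ⟨a₂, rfl⟩ := exists_ρ_orbitPt c c' z₂
    change (c.hom.hom.hom.hom (c.src.A.obj.ρ a₁ (pt₁ c)) : P.A.obj.V) =
      c.hom.hom.hom.hom (c.src.A.obj.ρ a₂ (pt₁ c)) at hz
    rw [hom_ρ, hom_ρ] at hz
    have hh : P.A.obj.ρ (a₁⁻¹ * a₂) (c.hom.hom.hom.hom (pt₁ c)) = c.hom.hom.hom.hom (pt₁ c) := by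
      rw [ρ_mul_apply, ← hz, ρ_inv_apply]
    obtain ⟨k, hk, k', hk', hst, hpt⟩ := exists_kernel_pair c c' hh
    let g := BTemp.restrictOrbit _ _ ⟨_, hst⟩
    have hgpt : (g.hom.hom.hom (BTemp.orbitPt _ _) : (coverObj c c').obj.V) =
        (coverObj c c').obj.ρ (a₁⁻¹ * a₂) (BTemp.orbitPt _ _) := Subtype.ext hpt
    refine ⟨g, ⟨restrictOrbit_mem_coverGroup c c' _ hst, ?_⟩, ?_⟩
    · -- `(k″, k‴) ≫ t ≫ (B″ → B) = t ≫ (B″ → B)` pointwise, since `k″ ∈ Ker(Γ_B″ → Γ_B)`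
      exact hom_ext_apply fun z =>
        congrArg (fun φ : c.src.A ⟶ P.A => (φ.hom.hom z.1.1.1 : P.A.obj.V)) hk.2
    · have key := aut_apply_ρ_orbitPt c c' g a₁ (a₁⁻¹ * a₂) hgpt
      rw [mul_inv_cancel_left] at key
      exact key

/-! ### Surjectivity, 0-properness (shared helper) and 1-properness of `t`, `t′`, `t ≫ (B″ → B)` -/

/-- `t` is surjective on points. [cite: MochizukiSemiAnbd2006, Thm A.4 proof p.84] -/
theorem fst_surjective : Function.Surjective
    fun z : (coverPair c c').A.obj.V => ((fst c c').hom.hom.hom z : c.src.A.obj.V) := by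
  intro y
  obtain ⟨a, rfl⟩ := exists_ρ_eq_of_isConnectedObj c.src.A c.isStronglyConnected (pt₁ c) y
  exact ⟨(coverObj c c').obj.ρ a (BTemp.orbitPt _ _), rfl⟩

/-- `t′` is surjective on points. [cite: MochizukiSemiAnbd2006, Thm A.4 proof p.84] -/
theorem snd_surjective : Function.Surjective
    fun z : (coverPair c c').A.obj.V => ((snd c c').hom.hom.hom z : c'.src.A.obj.V) := by
  intro y
  obtain ⟨a, rfl⟩ := exists_ρ_eq_of_isConnectedObj c'.src.A c'.isStronglyConnected (pt₂ c c') y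
  exact ⟨(coverObj c c').obj.ρ a (BTemp.orbitPt _ _), rfl⟩

/-- `t ≫ (B″ → B)` is surjective on points. [cite: MochizukiSemiAnbd2006, Thm A.4 proof p.84] -/
theorem comp_surjective : Function.Surjective
    fun z : (coverPair c c').A.obj.V => ((fst c c' ≫ c.hom).hom.hom.hom z : P.A.obj.V) := by
  intro y
  obtain ⟨x, rfl⟩ := c.hom_surjective y
  obtain ⟨a, rfl⟩ := exists_ρ_eq_of_isConnectedObj c.src.A c.isStronglyConnected (pt₁ c) x
  exact ⟨(coverObj c c').obj.ρ a (BTemp.orbitPt _ _), rfl⟩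

/-- **`t : (B⁗, Γ_B⁗) → (B″, Γ_B″)` is 1-proper.** [cite: MochizukiSemiAnbd2006, Thm A.4 proof p.84] -/
theorem fst_isOneProper : Hom.IsOneProper (fst c c') :=
  ⟨isZeroProper_of_surjective _ (fst_surjective c c'), fst_lift c c', fst_isQuotient c c'⟩

/-- **`t′ : (B⁗, Γ_B⁗) → (B‴, Γ_B‴)` is 1-proper.** [cite: MochizukiSemiAnbd2006, Thm A.4 proof p.84] -/
theorem snd_isOneProper : Hom.IsOneProper (snd c c') :=
  ⟨isZeroProper_of_surjective _ (snd_surjective c c'), snd_lift c c', snd_isQuotient c c'⟩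

/-- **`(B⁗, Γ_B⁗) → (B, Γ_B)` is 1-proper.** [cite: MochizukiSemiAnbd2006, Thm A.4 proof p.84] -/
theorem comp_isOneProper : Hom.IsOneProper (fst c c' ≫ c.hom) :=
  ⟨isZeroProper_of_surjective _ (comp_surjective c c'), comp_lift c c', comp_isQuotient c c'⟩

end OneProperCover

/-! ### The theorem, and what it gives for `Hom^ → Hom_T` -/

variable {G : Type u} [Group G] [TopologicalSpace G] [IsTopologicalGroup G]

/-- **"any two 1-proper morphisms of strongly connected QD-pairs `(B″, Γ_B″) → (B, Γ_B)`,
`(B‴, Γ_B‴) → (B, Γ_B)` fit into a commutative diagram of 1-proper morphisms of strongly connected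
QD-pairs"** — for every QD-pair of `B^temp(Π)` the 1-proper covers by strongly connected pairs form a
DIRECTED system: the named statement `OneProperCoversDirected P` PROVED.
[cite: MochizukiSemiAnbd2006, Thm A.4 proof p.84] -/
theorem oneProperCoversDirected (P : QDPair (BTemp G)) : OneProperCoversDirected P :=
  fun c c' =>
    -- the common refinement `(B⁗, Γ_B⁗) → (B, Γ_B)` and its two transitions
    ⟨{ src := OneProperCover.coverPair c c'
       hom := OneProperCover.fst c c' ≫ c.hom
       isStronglyConnected := OneProperCover.coverObj_isConnectedObj c c'
       isOneProper := OneProperCover.comp_isOneProper c c' },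
      ⟨⟨OneProperCover.fst c c', rfl, OneProperCover.fst_isOneProper c c'⟩⟩,
      ⟨⟨OneProperCover.snd c c', OneProperCover.snd_comp_eq_fst_comp c c',
        OneProperCover.snd_isOneProper c c'⟩⟩⟩

/-- **`Hom^((B, Γ_B), (C, Γ_C)) → Hom_{T}(B/Γ_B, C/Γ_C)` is injective**, for every pair of QD-pairs
of `B^temp(Π)` (directedness + the injection `Hom̄ ↪ Hom_T` for strongly connected sources).
[cite: MochizukiSemiAnbd2006, Thm A.4 proof p.84] -/
theorem homHatToHom_injective (P C : QDPair (BTemp G)) : Function.Injective (homHatToHom P C) :=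
  homHatToHom_injective_of_directed (oneProperCoversDirected P)

/-- **The reconstruction "`Hom_T(B/Γ_B, C/Γ_C) ≅ lim_→ Hom̄((B′, Γ_B′), (C, Γ_C))`" REDUCED to the
realisation clause alone** (`HomHatRealised P C`, row A4-S-real): directedness is now proved.
[cite: MochizukiSemiAnbd2006, Thm A.4 proof p.84] -/
theorem homHatReconstructs_of_realised {P C : QDPair (BTemp G)} (hreal : HomHatRealised P C) :
    HomHatReconstructs P C :=
  homHatReconstructs_of (oneProperCoversDirected P) hreal

end QDPair

end Literature.AnabelianGeometry.SemiGraphs
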